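import Literature.RepresentationTheory.AlgebraicGroups.SL2SymPower
import HarnessLib

/-!
# FLOOR-0 P3b «ENGINE local packets T3 ∕ T4», line `F0_LocalAPackets` — brief β1 (a): the DERIVATION MATRIX `dSym^m(X)` of the
# symmetric-power representation (any commutative ring)

Cell hodgecm-mathlib (D-0151), FLOOR 0, crux item H413 = stmt-HodgeConjecture-24833; sub-line `Cruxes/H413/Lines/F0_LocalAPackets.lean`
(F0P3b-plan, ed. 1.1), waypoint W1 of the load-bearing stub T3a₁ `StubT3aRealisationDatum` (the `K`-action on Kovačević's `ladderPlus` is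
built from ★ `symPowerMat` blocks; `IsGKModule.hasWeakDeriv` needs `d/dt Sym^{n−1}(exp tX)|₀ = dSym^{n−1}(X)`).  Brief β1 of F0P3b-plan (g5),
2026-08-31T01:25:35Z (3), item (a).  Author A-p18 (g17).  DEF lane: ONE definition with body (`dSymPowerMat`) + its algebra (theorems);
no `sorry`, no instance, no notation, no named fact; imports ★ `Literature/RepresentationTheory/AlgebraicGroups/SL2SymPower` only.  The
calculus (items (b), (c): continuity, `HasDerivAt` along `exp (t • X)`) is the companion `Theorems/F0P3bSymPowerCalculus.lean`.

`dSymPowerMat m X` is the matrix, in the monomial basis `X₀^{m−j} X₁^j` of ★ `symPowerMat`, of the DERIVATION `D_X` of `k[X₀, X₁]` extending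
the infinitesimal substitution of ★ `symAct` (`X_i ↦ Σ_j g_{ji} X_j`, so `D_X(X₀) = x₀₀X₀ + x₁₀X₁`, `D_X(X₁) = x₀₁X₀ + x₁₁X₁`):
`D_X(X₀^{m−j}X₁^j) = ((m−j)x₀₀ + j x₁₁)·X₀^{m−j}X₁^j + (m−j)x₁₀·X₀^{m−j−1}X₁^{j+1} + j x₀₁·X₀^{m−j+1}X₁^{j−1}` — TRIDIAGONAL, linear in `X`;
its values on the matrix units match the first-order terms of the ★ closed forms `symPowerMat_upper ∕ _lower ∕ _diagonal`
(`C(j, j−1) = j` at `(j−1, j)`, `C(m−j, 1) = m−j` at `(j+1, j)`, `(m−j)` ∕ `j` on the diagonal).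

HONEST LABEL: HC_CM is proved only modulo the printed citations until rung 0 closes; this file is bookkeeping for the algebraic representation
`Sym^m : GL₂ → GL_{m+1}` and discharges nothing printed.  References: [BorelWallach2000] 0 §2.5; [Kovacevic2021] §3.
-/

set_option autoImplicit false
set_option linter.dupNamespace false

noncomputable section

open MvPolynomial Literature.RepresentationTheory.AlgebraicGroups.SL2Sym

namespace Summit.HodgeConjecture.HodgeConjecture.Cruxes.H413.F0P3bSymPowerDerivation

/-! ## §1 The derivation matrix `dSym^m(X)` (any commutative ring) -/

section Algebra

variable {k : Type*} [CommRing k]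

/-- **`dSym^m(X)`, the derivative of `Sym^m` at the identity in the direction `X`**: the matrix, in the monomial basis
`X₀^{m−j} X₁^j` (`j = 0, …, m`; the basis of ★ `symPowerMat`), of the derivation of `k[X₀, X₁]` with `X₀ ↦ x₀₀ X₀ + x₁₀ X₁`,
`X₁ ↦ x₀₁ X₀ + x₁₁ X₁` (the infinitesimal form of ★ `symAct`'s substitution `X_i ↦ Σ_j g_{ji} X_j`):
column `j` has `(m−j)x₀₀ + j x₁₁` on the diagonal, `(m−j) x₁₀` at row `j+1` and `j x₀₁` at row `j−1` (tridiagonal).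
(BorelWallach2000, 0 §2.5) — a route-posited object of the engine line (the differential of an explicit polynomial representation), not
a result of the literature (hence untagged). -/
def dSymPowerMat (m : ℕ) (X : Matrix (Fin 2) (Fin 2) k) : Matrix (Fin (m + 1)) (Fin (m + 1)) k :=
  Matrix.of fun i j =>
    if i = j then ((m : k) - ((j : ℕ) : k)) * X 0 0 + ((j : ℕ) : k) * X 1 1
    else if (i : ℕ) = (j : ℕ) + 1 then ((m : k) - ((j : ℕ) : k)) * X 1 0
    else if (j : ℕ) = (i : ℕ) + 1 then ((j : ℕ) : k) * X 0 1
    else 0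

/-- The entries of `dSym^m(X)` (definitional unfolding). [folklore] -/
theorem dSymPowerMat_apply (m : ℕ) (X : Matrix (Fin 2) (Fin 2) k) (i j : Fin (m + 1)) :
    dSymPowerMat m X i j =
      if i = j then ((m : k) - ((j : ℕ) : k)) * X 0 0 + ((j : ℕ) : k) * X 1 1
      else if (i : ℕ) = (j : ℕ) + 1 then ((m : k) - ((j : ℕ) : k)) * X 1 0
      else if (j : ℕ) = (i : ℕ) + 1 then ((j : ℕ) : k) * X 0 1
      else 0 := rfl

/-- `dSym^m` is additive in `X`. [folklore] -/
theorem dSymPowerMat_add (m : ℕ) (X Y : Matrix (Fin 2) (Fin 2) k) :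
    dSymPowerMat m (X + Y) = dSymPowerMat m X + dSymPowerMat m Y := by
  ext i j
  simp only [dSymPowerMat_apply, Matrix.add_apply]
  split_ifs <;> ring

/-- `dSym^m` is homogeneous in `X`. [folklore] -/
theorem dSymPowerMat_smul (m : ℕ) (c : k) (X : Matrix (Fin 2) (Fin 2) k) :
    dSymPowerMat m (c • X) = c • dSymPowerMat m X := by
  ext i j
  simp only [dSymPowerMat_apply, Matrix.smul_apply, smul_eq_mul]
  split_ifs <;> ring

/-- `dSym^m(0) = 0`. [folklore] -/
theorem dSymPowerMat_zero (m : ℕ) : dSymPowerMat m (0 : Matrix (Fin 2) (Fin 2) k) = 0 := by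
  ext i j
  simp only [dSymPowerMat_apply, Matrix.zero_apply, mul_zero, add_zero, ite_self]

/-- `dSym^m` of a finite sum. [folklore] -/
theorem dSymPowerMat_sum (m : ℕ) {ι : Type*} (s : Finset ι) (f : ι → Matrix (Fin 2) (Fin 2) k) :
    dSymPowerMat m (∑ x ∈ s, f x) = ∑ x ∈ s, dSymPowerMat m (f x) := by
  classical
  induction s using Finset.induction_on with
  | empty => rw [Finset.sum_empty, Finset.sum_empty, dSymPowerMat_zero]
  | insert a s ha ih => rw [Finset.sum_insert ha, Finset.sum_insert ha, dSymPowerMat_add, ih]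

/-- **Linearity on the matrix units**: `dSym^m(X)_{ij} = Σ_{a,b} X_{ab} · dSym^m(E_{ab})_{ij}`. [folklore] -/
theorem dSymPowerMat_apply_eq_sum_single (m : ℕ) (X : Matrix (Fin 2) (Fin 2) k) (i j : Fin (m + 1)) :
    dSymPowerMat m X i j = ∑ a : Fin 2, ∑ b : Fin 2, X a b * dSymPowerMat m (Matrix.single a b (1 : k)) i j := by
  conv_lhs => rw [Matrix.matrix_eq_sum_single X, dSymPowerMat_sum, Matrix.sum_apply]
  refine Finset.sum_congr rfl fun a _ => ?_
  rw [dSymPowerMat_sum, Matrix.sum_apply]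
  refine Finset.sum_congr rfl fun b _ => ?_
  have hs : Matrix.single a b (X a b) = X a b • Matrix.single a b (1 : k) := by
    ext i' j'
    simp only [Matrix.single_apply, Matrix.smul_apply, smul_eq_mul, mul_ite, mul_one, mul_zero]
  rw [hs, dSymPowerMat_smul, Matrix.smul_apply, smul_eq_mul]

/-- `dSym^m(E₀₁)`: only the super-diagonal `(j−1, j) ↦ j` (`X₁ ↦ X₀` lowers the `X₁`-degree). [folklore] -/
theorem dSymPowerMat_single_zero_one (m : ℕ) (i j : Fin (m + 1)) :
    dSymPowerMat m (Matrix.single 0 1 (1 : k)) i j = if (j : ℕ) = (i : ℕ) + 1 then ((j : ℕ) : k) else 0 := by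
  have h00 : Matrix.single (0 : Fin 2) (1 : Fin 2) (1 : k) 0 0 = 0 := by simp
  have h11 : Matrix.single (0 : Fin 2) (1 : Fin 2) (1 : k) 1 1 = 0 := by simp
  have h10 : Matrix.single (0 : Fin 2) (1 : Fin 2) (1 : k) 1 0 = 0 := by simp
  have h01 : Matrix.single (0 : Fin 2) (1 : Fin 2) (1 : k) 0 1 = 1 := by simp
  rw [dSymPowerMat_apply]
  simp only [h00, h11, h10, h01, mul_zero, mul_one, add_zero]
  by_cases h1 : i = j
  · subst h1
    rw [if_pos rfl, if_neg (by omega)]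
  · rw [if_neg h1]
    by_cases h2 : (i : ℕ) = (j : ℕ) + 1
    · rw [if_pos h2, if_neg (by omega)]
    · rw [if_neg h2]

/-- `dSym^m(E₁₀)`: only the sub-diagonal `(j+1, j) ↦ m − j`. [folklore] -/
theorem dSymPowerMat_single_one_zero (m : ℕ) (i j : Fin (m + 1)) :
    dSymPowerMat m (Matrix.single 1 0 (1 : k)) i j = if (i : ℕ) = (j : ℕ) + 1 then ((m : k) - ((j : ℕ) : k)) else 0 := by
  have h00 : Matrix.single (1 : Fin 2) (0 : Fin 2) (1 : k) 0 0 = 0 := by simp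
  have h11 : Matrix.single (1 : Fin 2) (0 : Fin 2) (1 : k) 1 1 = 0 := by simp
  have h10 : Matrix.single (1 : Fin 2) (0 : Fin 2) (1 : k) 1 0 = 1 := by simp
  have h01 : Matrix.single (1 : Fin 2) (0 : Fin 2) (1 : k) 0 1 = 0 := by simp
  rw [dSymPowerMat_apply]
  simp only [h00, h11, h10, h01, mul_zero, mul_one, add_zero]
  by_cases h1 : i = j
  · subst h1
    rw [if_pos rfl, if_neg (by omega)]
  · rw [if_neg h1]
    by_cases h2 : (i : ℕ) = (j : ℕ) + 1
    · rw [if_pos h2, if_pos h2]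
    · rw [if_neg h2, if_neg h2]
      split_ifs <;> rfl

/-- `dSym^m(E₀₀)`: diagonal `j ↦ m − j`. [folklore] -/
theorem dSymPowerMat_single_zero_zero (m : ℕ) (i j : Fin (m + 1)) :
    dSymPowerMat m (Matrix.single 0 0 (1 : k)) i j = if i = j then ((m : k) - ((j : ℕ) : k)) else 0 := by
  have h00 : Matrix.single (0 : Fin 2) (0 : Fin 2) (1 : k) 0 0 = 1 := by simp
  have h11 : Matrix.single (0 : Fin 2) (0 : Fin 2) (1 : k) 1 1 = 0 := by simp
  have h10 : Matrix.single (0 : Fin 2) (0 : Fin 2) (1 : k) 1 0 = 0 := by simp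
  have h01 : Matrix.single (0 : Fin 2) (0 : Fin 2) (1 : k) 0 1 = 0 := by simp
  rw [dSymPowerMat_apply]
  simp only [h00, h11, h10, h01, mul_zero, mul_one, add_zero]
  by_cases h1 : i = j
  · rw [if_pos h1, if_pos h1]
  · rw [if_neg h1, if_neg h1]
    split_ifs <;> rfl

/-- `dSym^m(E₁₁)`: diagonal `j ↦ j`. [folklore] -/
theorem dSymPowerMat_single_one_one (m : ℕ) (i j : Fin (m + 1)) :
    dSymPowerMat m (Matrix.single 1 1 (1 : k)) i j = if i = j then ((j : ℕ) : k) else 0 := by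
  have h00 : Matrix.single (1 : Fin 2) (1 : Fin 2) (1 : k) 0 0 = 0 := by simp
  have h11 : Matrix.single (1 : Fin 2) (1 : Fin 2) (1 : k) 1 1 = 1 := by simp
  have h10 : Matrix.single (1 : Fin 2) (1 : Fin 2) (1 : k) 1 0 = 0 := by simp
  have h01 : Matrix.single (1 : Fin 2) (1 : Fin 2) (1 : k) 0 1 = 0 := by simp
  rw [dSymPowerMat_apply]
  simp only [h00, h11, h10, h01, mul_zero, mul_one, zero_add]
  by_cases h1 : i = j
  · rw [if_pos h1, if_pos h1]
  · rw [if_neg h1, if_neg h1]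
    split_ifs <;> rfl

end Algebra

end Summit.HodgeConjecture.HodgeConjecture.Cruxes.H413.F0P3bSymPowerDerivation

end
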